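import Mathlib
import HarnessLib
import Literature.Probability.LatticeModels.TorusFourierAdditiveTimeMoment
import Literature.MathematicalPhysics.QuantumLattice.HubbardScaleZeroSectorSymbolTimeHigher
import Summits.HubbardSuperconductivity.HubbardSuperconductivity.Theorems.KLProgrammeKLRegimeTorusL1SecondDifferences
import Summits.HubbardSuperconductivity.HubbardSuperconductivity.Theorems.KLProgrammeKLRegimeTorusAdditiveSexticWeightMoment

/-!
# Route `KLProgramme` — engine support (route (L2), ADDITIVE weight, FIRST MOMENT): the `klScaleWt`-type WEIGHTED `ℓ¹` norm of a space-time
# character sum from the sup, the support count and pointwise single-direction THIRD differences of its symbol — the master lemma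

Cell `gate-hubbard-kl`, seat p3 (g9), for the ENGINE child stmt-HubbardSuperconductivity-20437 (`stub_engine_step_norms`, the WEIGHTED lines at the levels
`j ≥ 1`; memo HOME/p3/g9/WT-DECAY-SCALES.md = evidence #17).  The block/slice WEIGHTED row and column sums `α_w` of a sectorised covariance
(`hrow`/`hcol` of the weighted determinant-bounded steps `GrassmannWeightedEffectiveAction…`, tree weight `klScaleWt … j = 1 + Λ_j·d`) are weighted
`ℓ¹` norms `Σ_z (1 + Λ·d(z))‖S(z)‖` of product-torus character sums `S(z) = Σ_q χ_{q₁}(z₁)χ_{q₂}(z₂) • G(q)` over `(ℤ/Pℤ)¹ × (ℤ/Lℤ)²` — the twin, with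
ONE position moment, of k3c2-p3's `…TorusL1SecondDifferences.sum_norm_charSum_le_of_second_differences` (plain `ℓ¹`, order two).  A first moment
needs order THREE (the inverse-weight sum with the squared moment numerator diverges like `log L` at order two — `…TorusAdditiveSexticWeightMoment`):

  **`sum_wt_norm_charSum_le_of_third_differences`** — if `‖G‖ ≤ A₀`, `#{G ≠ 0} ≤ N_s`, and in each of the five directions `w` (time, the two
  axes, the integer frame `(v⊥, v)`) the THIRD difference obeys `‖Δ_w³ G‖ ≤ A₀·(4/(s_w P_w))³` pointwise, then
  `Σ_z (1 + s₀|z̃₁| + s₁|z̃₂,₁| + s₁|z̃₂,₂|)·‖S(z)‖ ≤ √(32768(1/s₀+1)[C_w²·4(2√2/(s₂|v|)+2)(2√2/(s₃|v|)+2) + 16(1/s₁+1)²/(1+s₁R₀)]) · √(21·P·L²·N_s) · A₀`,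
  `C_w = 1 + 2√2·s₁/(s₂|v|) + 2√2·s₁/(s₃|v|)`, for every near radius `R₀` with `2(|v₁|+|v₂|)R₀ < L`

(Literature's `TorusFourierAdditiveTimeMoment.sum_sum_mul_norm_prodChar_le_additive` at `(N₀, N₁) = (3, 3)` with the monomial `m = 1 + X + I₁ + I₂`,
the inverse-weight factor `sum_sq_mul_inv_additiveSexticWeight_le`, and `sum_norm_sq_fwdDiff_iter_le` for the `ℓ²` sizes of third differences:
`1 + 5·4 = 21`).  Any weight `1 + Λ·(κ_t|z̃₁| + |z̃₂|_1)` with `Λκ_t ≤ s₀`, `Λ ≤ s₁` is below the moment factor.  With the scales of a sector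
propagator at `Λ_j` on a frame (rates as in the order-two file, third-order symbol data) this is `Σ_z (1 + Λ_j·d(z))|g(z)| ≲ (P/β)·Λ_j⁻¹`, i.e.
`α_w ≍ α` (Benfatto–Giuliani–Mastropietro 2006, Lemma 2.2 (2.52) with `N = 3`).  Everything is proved; no definitions, no named facts. [folklore]

References: G. Benfatto, A. Giuliani, V. Mastropietro, Ann. Henri Poincaré 7 (2006) 809–898, Lemma 2.2, (2.36aa), (2.52), (2.81) and footnote ¹;
M. Disertori, V. Rivasseau, Comm. Math. Phys. 215 (2000) 251–290, §IV.2 Lemma 4, App. A Lemma 12.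
-/

noncomputable section

namespace Summit.HubbardSuperconductivity.HubbardSuperconductivity.Theorems.TorusFourierL2

set_option linter.dupNamespace false -- summit = problem name (single-conjunct summit), D-0017

open Finset Literature.Probability.LatticeModels Literature.MathematicalPhysics.QuantumLattice
open scoped Real

/-- **The weighted `ℓ¹` norm (one position moment) of a space-time character sum from the sup, the support count and pointwise single-direction
THIRD differences of its symbol.**  Data: rates `s₀, s₁, s₂, s₃ > 0`, an integer direction `v ≠ 0` with frame `(v⊥, v)`, a near radius `R₀` with
`2(|v₁|+|v₂|)R₀ < L`; a symbol `G` on `(ℤ/Pℤ)¹ × (ℤ/Lℤ)²` with `‖G‖ ≤ A₀`, `#{G ≠ 0} ≤ N_s`, and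
`‖Δ³_{(1,0)} G‖ ≤ A₀(4/(s₀P))³`, `‖Δ³_{(0,eᵢ)} G‖ ≤ A₀(4/(s₁L))³` (`i = 1,2`), `‖Δ³_{(0,v⊥)} G‖ ≤ A₀(4/(s₂L))³`, `‖Δ³_{(0,v)} G‖ ≤ A₀(4/(s₃L))³`.
THEN `Σ_z (1 + s₀|z̃₁| + s₁|(z₂)̃₁| + s₁|(z₂)̃₂|)·‖Σ_q χ_{q₁}(z₁)χ_{q₂}(z₂) • G(q)‖
  ≤ √(32768(1/s₀+1)[C_w²·4(2√2/(s₂|v|)+2)(2√2/(s₃|v|)+2) + 16(1/s₁+1)²/(1+s₁R₀)])·√(21·P·L²·N_s)·A₀`, `C_w = 1 + 2√2·s₁/(s₂|v|) + 2√2·s₁/(s₃|v|)`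
(Cauchy–Schwarz with the monomial against the additive sextic weight, Plancherel with third differences, `sum_sq_mul_inv_additiveSexticWeight_le`).
[cite: BenfattoGiulianiMastropietro2006, Lemma 2.2 (2.52), §2.6 (2.81) and footnote 1] -/
theorem sum_wt_norm_charSum_le_of_third_differences {P L : ℕ} [NeZero P] [NeZero L] (G : TorusSite 1 P × TorusSite 2 L → ℂ)
    (v : Fin 2 → ℤ) (hv : v ≠ 0) {s₀ s₁ s₂ s₃ : ℝ} (hs₀ : 0 < s₀) (hs₁ : 0 < s₁) (hs₂ : 0 < s₂) (hs₃ : 0 < s₃)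
    {R₀ : ℕ} (hR₀ : 2 * (|v 0| + |v 1|) * (R₀ : ℤ) < L) {A₀ : ℝ} (hA₀ : 0 ≤ A₀) {Ns : ℕ}
    (hsupp : (univ.filter fun q => G q ≠ 0).card ≤ Ns) (hsup : ∀ q, ‖G q‖ ≤ A₀)
    (h₀ : ∀ q, ‖(fwdDiff ((fun _ : Fin 1 => (1 : ZMod P)), (0 : TorusSite 2 L)))^[3] G q‖ ≤ A₀ * (4 / (s₀ * P)) ^ 3)
    (h₁ : ∀ q (i : Fin 2), ‖(fwdDiff ((0 : TorusSite 1 P), (Pi.single i (1 : ZMod L) : TorusSite 2 L)))^[3] G q‖ ≤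
      A₀ * (4 / (s₁ * L)) ^ 3)
    (h₂ : ∀ q, ‖(fwdDiff ((0 : TorusSite 1 P), (fun j => ((![-v 1, v 0] j : ℤ) : ZMod L))))^[3] G q‖ ≤ A₀ * (4 / (s₂ * L)) ^ 3)
    (h₃ : ∀ q, ‖(fwdDiff ((0 : TorusSite 1 P), (fun j => ((v j : ℤ) : ZMod L))))^[3] G q‖ ≤ A₀ * (4 / (s₃ * L)) ^ 3) :
    ∑ z : TorusSite 1 P × TorusSite 2 L,
      (1 + s₀ * |(((z.1 0).valMinAbs : ℤ) : ℝ)| + s₁ * |(((z.2 0).valMinAbs : ℤ) : ℝ)| + s₁ * |(((z.2 1).valMinAbs : ℤ) : ℝ)|) *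
        ‖∑ q : TorusSite 1 P × TorusSite 2 L, (torusChar q.1 z.1 * torusChar q.2 z.2) • G q‖ ≤
      Real.sqrt (32768 * (1 / s₀ + 1) *
          ((1 + 2 * Real.sqrt 2 * s₁ / (s₂ * Real.sqrt ((v 0 : ℝ) ^ 2 + (v 1 : ℝ) ^ 2)) +
              2 * Real.sqrt 2 * s₁ / (s₃ * Real.sqrt ((v 0 : ℝ) ^ 2 + (v 1 : ℝ) ^ 2))) ^ 2 *
            (4 * ((2 * Real.sqrt 2 / (s₂ * Real.sqrt ((v 0 : ℝ) ^ 2 + (v 1 : ℝ) ^ 2)) + 2) *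
              (2 * Real.sqrt 2 / (s₃ * Real.sqrt ((v 0 : ℝ) ^ 2 + (v 1 : ℝ) ^ 2)) + 2)))
            + 16 * (1 / s₁ + 1) ^ 2 / (1 + s₁ * R₀))) *
        Real.sqrt (21 * P * (L : ℝ) ^ 2 * Ns) * A₀ := by
  classical
  -- the four space directions, indexed by `Fin 4`: e₁, e₂, v⊥, v
  obtain ⟨dir, hdir⟩ : ∃ dir : Fin 4 → TorusSite 2 L, dir = ![(Pi.single 0 (1 : ZMod L) : TorusSite 2 L),
    (Pi.single 1 (1 : ZMod L) : TorusSite 2 L), (fun j => ((![-v 1, v 0] j : ℤ) : ZMod L)), (fun j => ((v j : ℤ) : ZMod L))] :=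
    ⟨_, rfl⟩
  obtain ⟨rate, hrate⟩ : ∃ rate : Fin 4 → ℝ, rate = ![s₁, s₁, s₂, s₃] := ⟨_, rfl⟩
  obtain ⟨u, hu⟩ : ∃ u : TorusSite 1 P, u = fun _ => (1 : ZMod P) := ⟨_, rfl⟩
  obtain ⟨c₀, hc₀⟩ : ∃ c₀ : ℝ, c₀ = (s₀ * P / 4) ^ 6 := ⟨_, rfl⟩
  obtain ⟨c, hc⟩ : ∃ c : Fin 4 → ℝ, c = fun i => (rate i * L / 4) ^ 6 := ⟨_, rfl⟩
  -- the moment monomial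
  obtain ⟨m, hm⟩ : ∃ m : TorusSite 1 P → TorusSite 2 L → ℝ, m = fun a b =>
      1 + s₀ * |(((a 0).valMinAbs : ℤ) : ℝ)| + s₁ * |(((b 0).valMinAbs : ℤ) : ℝ)| + s₁ * |(((b 1).valMinAbs : ℤ) : ℝ)| := ⟨_, rfl⟩
  have hm0 : ∀ a b, 0 ≤ m a b := fun a b => by rw [hm]; positivity
  have hrate_pos : ∀ i, 0 < rate i := fun i => by subst hrate; fin_cases i <;> simp [hs₁, hs₂, hs₃]
  have hc₀0 : 0 ≤ c₀ := by rw [hc₀]; positivity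
  have hci0 : ∀ i, 0 ≤ c i := fun i => by rw [hc]; positivity
  have hc0 : ∀ i ∈ (univ : Finset (Fin 4)), 0 ≤ c i := fun i _ => hci0 i
  obtain ⟨Gc, hGc⟩ : ∃ Gc : TorusSite 1 P → TorusSite 2 L → ℂ, Gc = fun a b => G (a, b) := ⟨_, rfl⟩
  -- Literature's ℓ² route with the monomial and the additive weight of orders `(3, 3)`
  have hmain := sum_sum_mul_norm_prodChar_le_additive (univ : Finset (Fin 4)) u c₀ hc₀0 dir c hc0 3 3 m hm0 Gc
  -- (1) rewrite the left-hand side into the pair form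
  have hLHS : ∑ z : TorusSite 1 P × TorusSite 2 L,
      (1 + s₀ * |(((z.1 0).valMinAbs : ℤ) : ℝ)| + s₁ * |(((z.2 0).valMinAbs : ℤ) : ℝ)| + s₁ * |(((z.2 1).valMinAbs : ℤ) : ℝ)|) *
        ‖∑ q : TorusSite 1 P × TorusSite 2 L, (torusChar q.1 z.1 * torusChar q.2 z.2) • G q‖ =
      ∑ a : TorusSite 1 P, ∑ b : TorusSite 2 L, m a b * ‖∑ p, ∑ p', torusChar p a * torusChar p' b * Gc p p'‖ := by
    rw [Fintype.sum_prod_type]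
    refine sum_congr rfl fun a _ => sum_congr rfl fun b _ => ?_
    rw [charSum_pair_eq_curried, hGc, hm]
  rw [hLHS]
  refine hmain.trans ?_
  -- (2) the weight factor: identify the weight with the additive sextic weight and the monomial with `1 + X + I₁ + I₂`
  have hP : (0 : ℝ) < P := Nat.cast_pos.2 (Nat.pos_of_ne_zero (NeZero.ne P))
  have hL : (0 : ℝ) < L := Nat.cast_pos.2 (Nat.pos_of_ne_zero (NeZero.ne L))
  have hweight_eq : ∀ (a : TorusSite 1 P) (b : TorusSite 2 L),
      m a b ^ 2 * (1 + c₀ * (4 * |((∑ j, u j * a j).valMinAbs : ℝ)| / P) ^ (2 * 3) +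
        ∑ i ∈ (univ : Finset (Fin 4)), c i * (4 * |((∑ j, dir i j * b j).valMinAbs : ℝ)| / L) ^ (2 * 3))⁻¹ =
      (1 + s₀ * |(((a 0).valMinAbs : ℤ) : ℝ)| + s₁ * |(((b 0).valMinAbs : ℤ) : ℝ)| + s₁ * |(((b 1).valMinAbs : ℤ) : ℝ)|) ^ 2 *
      (1 + (s₀ * |(((a 0).valMinAbs : ℤ) : ℝ)|) ^ 6 + (s₁ * |(((b 0).valMinAbs : ℤ) : ℝ)|) ^ 6 +
        (s₁ * |(((b 1).valMinAbs : ℤ) : ℝ)|) ^ 6 +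
        (s₂ * |(((∑ j, ((![-v 1, v 0] j : ℤ) : ZMod L) * b j).valMinAbs : ℤ) : ℝ)|) ^ 6 +
        (s₃ * |(((∑ j, ((v j : ℤ) : ZMod L) * b j).valMinAbs : ℤ) : ℝ)|) ^ 6)⁻¹ := by
    intro a b
    have hua : (∑ j, u j * a j) = a 0 := by simp [hu]
    have hb0 : (∑ j, dir 0 j * b j) = b 0 := by simp [hdir, Pi.single_apply]
    have hb1 : (∑ j, dir 1 j * b j) = b 1 := by simp [hdir, Pi.single_apply]
    have hb2 : (∑ j, dir 2 j * b j) = ∑ j, ((![-v 1, v 0] j : ℤ) : ZMod L) * b j := by simp [hdir]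
    have hb3 : (∑ j, dir 3 j * b j) = ∑ j, ((v j : ℤ) : ZMod L) * b j := by simp [hdir]
    rw [Fin.sum_univ_four, hua, hb0, hb1, hb2, hb3, hc, hc₀, hm]
    have hr0 : rate 0 = s₁ := by rw [hrate]; rfl
    have hr1 : rate 1 = s₁ := by rw [hrate]; rfl
    have hr2 : rate 2 = s₂ := by rw [hrate]; rfl
    have hr3 : rate 3 = s₃ := by rw [hrate]; rfl
    simp only [hr0, hr1, hr2, hr3]
    have key : ∀ (s Q x : ℝ), 0 < Q → (s * Q / 4) ^ 6 * (4 * x / Q) ^ (2 * 3) = (s * x) ^ 6 := by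
      intro s Q x hQ
      rw [show 2 * 3 = 6 by norm_num, ← mul_pow]
      congr 1
      field_simp
    rw [key _ _ _ hP, key _ _ _ hL, key _ _ _ hL, key _ _ _ hL, key _ _ _ hL]
    push_cast
    ring
  have hW := sum_sq_mul_inv_additiveSexticWeight_le (P := P) (L := L) v hv hs₀ hs₁ hs₂ hs₃ hR₀
  have hweight : Real.sqrt (∑ a : TorusSite 1 P, ∑ b : TorusSite 2 L,
      m a b ^ 2 * (1 + c₀ * (4 * |((∑ j, u j * a j).valMinAbs : ℝ)| / P) ^ (2 * 3) +
        ∑ i ∈ (univ : Finset (Fin 4)), c i * (4 * |((∑ j, dir i j * b j).valMinAbs : ℝ)| / L) ^ (2 * 3))⁻¹) ≤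
      Real.sqrt (32768 * (1 / s₀ + 1) *
          ((1 + 2 * Real.sqrt 2 * s₁ / (s₂ * Real.sqrt ((v 0 : ℝ) ^ 2 + (v 1 : ℝ) ^ 2)) +
              2 * Real.sqrt 2 * s₁ / (s₃ * Real.sqrt ((v 0 : ℝ) ^ 2 + (v 1 : ℝ) ^ 2))) ^ 2 *
            (4 * ((2 * Real.sqrt 2 / (s₂ * Real.sqrt ((v 0 : ℝ) ^ 2 + (v 1 : ℝ) ^ 2)) + 2) *
              (2 * Real.sqrt 2 / (s₃ * Real.sqrt ((v 0 : ℝ) ^ 2 + (v 1 : ℝ) ^ 2)) + 2)))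
            + 16 * (1 / s₁ + 1) ^ 2 / (1 + s₁ * R₀))) := by
    refine Real.sqrt_le_sqrt ?_
    simp_rw [hweight_eq]
    rw [← Fintype.sum_prod_type']
    exact hW
  -- (3) the symbol factor
  have hsq0 : ∑ p, ∑ p', ‖Gc p p'‖ ^ 2 ≤ Ns * A₀ ^ 2 := by
    rw [← Fintype.sum_prod_type' (f := fun p p' => ‖Gc p p'‖ ^ 2), hGc]
    exact sum_norm_sq_le_of_support_card G hsupp hsup
  have htime : c₀ * ∑ p, ∑ p', ‖((fwdDiff u)^[3] (fun q => Gc q p')) p‖ ^ 2 ≤ 4 * Ns * A₀ ^ 2 := by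
    have hpt : ∀ q : TorusSite 1 P × TorusSite 2 L, ‖(fwdDiff (u, (0 : TorusSite 2 L)))^[3] G q‖ ≤ A₀ * (4 / (s₀ * P)) ^ 3 :=
      fun q => by rw [hu]; exact h₀ q
    have h := sum_norm_sq_fwdDiff_iter_le G (u, (0 : TorusSite 2 L)) 3 hsupp hpt
    have heq : ∑ p, ∑ p', ‖((fwdDiff u)^[3] (fun q => Gc q p')) p‖ ^ 2 =
        ∑ q : TorusSite 1 P × TorusSite 2 L, ‖(fwdDiff (u, (0 : TorusSite 2 L)))^[3] G q‖ ^ 2 := by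
      rw [Fintype.sum_prod_type]
      refine sum_congr rfl fun p _ => sum_congr rfl fun p' _ => ?_
      rw [Literature.Probability.LatticeModels.fwdDiff_iter_prod_fst, hGc]
    rw [heq]
    calc c₀ * ∑ q : TorusSite 1 P × TorusSite 2 L, ‖(fwdDiff (u, (0 : TorusSite 2 L)))^[3] G q‖ ^ 2
        ≤ c₀ * ((3 + 1) * Ns * (A₀ * (4 / (s₀ * P)) ^ 3) ^ 2) := mul_le_mul_of_nonneg_left h hc₀0
      _ = 4 * Ns * A₀ ^ 2 := by
          rw [hc₀]
          have : (s₀ * P / 4) ^ 6 * ((4 / (s₀ * P)) ^ 3) ^ 2 = 1 := by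
            rw [← pow_mul, show 3 * 2 = 6 by norm_num, ← mul_pow]
            have : s₀ * P / 4 * (4 / (s₀ * P)) = 1 := by field_simp
            rw [this, one_pow]
          calc (s₀ * ↑P / 4) ^ 6 * ((3 + 1) * ↑Ns * (A₀ * (4 / (s₀ * ↑P)) ^ 3) ^ 2)
              = 4 * Ns * A₀ ^ 2 * ((s₀ * P / 4) ^ 6 * ((4 / (s₀ * P)) ^ 3) ^ 2) := by ring
            _ = 4 * Ns * A₀ ^ 2 := by rw [this, mul_one]
  have hspace : ∀ i : Fin 4, c i * ∑ p, ∑ p', ‖((fwdDiff (dir i))^[3] (Gc p)) p'‖ ^ 2 ≤ 4 * Ns * A₀ ^ 2 := by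
    intro i
    have hpt : ∀ q : TorusSite 1 P × TorusSite 2 L, ‖(fwdDiff ((0 : TorusSite 1 P), dir i))^[3] G q‖ ≤
        A₀ * (4 / (rate i * L)) ^ 3 := by
      have hd0 : dir 0 = (Pi.single 0 (1 : ZMod L) : TorusSite 2 L) := by rw [hdir]; rfl
      have hd1 : dir 1 = (Pi.single 1 (1 : ZMod L) : TorusSite 2 L) := by rw [hdir]; rfl
      have hd2 : dir 2 = (fun j => ((![-v 1, v 0] j : ℤ) : ZMod L)) := by rw [hdir]; rfl
      have hd3 : dir 3 = (fun j => ((v j : ℤ) : ZMod L)) := by rw [hdir]; rfl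
      have hr0 : rate 0 = s₁ := by rw [hrate]; rfl
      have hr1 : rate 1 = s₁ := by rw [hrate]; rfl
      have hr2 : rate 2 = s₂ := by rw [hrate]; rfl
      have hr3 : rate 3 = s₃ := by rw [hrate]; rfl
      intro q
      fin_cases i
      · change ‖(fwdDiff ((0 : TorusSite 1 P), dir 0))^[3] G q‖ ≤ A₀ * (4 / (rate 0 * L)) ^ 3
        rw [hd0, hr0]; exact h₁ q 0
      · change ‖(fwdDiff ((0 : TorusSite 1 P), dir 1))^[3] G q‖ ≤ A₀ * (4 / (rate 1 * L)) ^ 3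
        rw [hd1, hr1]; exact h₁ q 1
      · change ‖(fwdDiff ((0 : TorusSite 1 P), dir 2))^[3] G q‖ ≤ A₀ * (4 / (rate 2 * L)) ^ 3
        rw [hd2, hr2]; exact h₂ q
      · change ‖(fwdDiff ((0 : TorusSite 1 P), dir 3))^[3] G q‖ ≤ A₀ * (4 / (rate 3 * L)) ^ 3
        rw [hd3, hr3]; exact h₃ q
    have h := sum_norm_sq_fwdDiff_iter_le G ((0 : TorusSite 1 P), dir i) 3 hsupp hpt
    have heq : ∑ p, ∑ p', ‖((fwdDiff (dir i))^[3] (Gc p)) p'‖ ^ 2 =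
        ∑ q : TorusSite 1 P × TorusSite 2 L, ‖(fwdDiff ((0 : TorusSite 1 P), dir i))^[3] G q‖ ^ 2 := by
      rw [Fintype.sum_prod_type]
      refine sum_congr rfl fun p _ => sum_congr rfl fun p' _ => ?_
      rw [Literature.Probability.LatticeModels.fwdDiff_iter_prod_snd, hGc]
    rw [heq]
    have hri := hrate_pos i
    calc c i * ∑ q : TorusSite 1 P × TorusSite 2 L, ‖(fwdDiff ((0 : TorusSite 1 P), dir i))^[3] G q‖ ^ 2
        ≤ c i * ((3 + 1) * Ns * (A₀ * (4 / (rate i * L)) ^ 3) ^ 2) := mul_le_mul_of_nonneg_left h (hc0 i (mem_univ _))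
      _ = 4 * Ns * A₀ ^ 2 := by
          rw [hc]
          have : (rate i * L / 4) ^ 6 * ((4 / (rate i * L)) ^ 3) ^ 2 = 1 := by
            rw [← pow_mul, show 3 * 2 = 6 by norm_num, ← mul_pow]
            have : rate i * L / 4 * (4 / (rate i * L)) = 1 := by field_simp
            rw [this, one_pow]
          calc (rate i * ↑L / 4) ^ 6 * ((3 + 1) * ↑Ns * (A₀ * (4 / (rate i * ↑L)) ^ 3) ^ 2)
              = 4 * Ns * A₀ ^ 2 * ((rate i * L / 4) ^ 6 * ((4 / (rate i * L)) ^ 3) ^ 2) := by ring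
            _ = 4 * Ns * A₀ ^ 2 := by rw [this, mul_one]
  have hsymbol : Real.sqrt ((P : ℝ) ^ 1 * (L : ℝ) ^ 2 *
      (∑ p, ∑ p', ‖Gc p p'‖ ^ 2 + c₀ * ∑ p, ∑ p', ‖((fwdDiff u)^[3] (fun q => Gc q p')) p‖ ^ 2 +
        ∑ i ∈ (univ : Finset (Fin 4)), c i * ∑ p, ∑ p', ‖((fwdDiff (dir i))^[3] (Gc p)) p'‖ ^ 2)) ≤
      Real.sqrt (21 * P * (L : ℝ) ^ 2 * Ns) * A₀ := by
    have hbr : ∑ p, ∑ p', ‖Gc p p'‖ ^ 2 + c₀ * ∑ p, ∑ p', ‖((fwdDiff u)^[3] (fun q => Gc q p')) p‖ ^ 2 +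
        ∑ i ∈ (univ : Finset (Fin 4)), c i * ∑ p, ∑ p', ‖((fwdDiff (dir i))^[3] (Gc p)) p'‖ ^ 2 ≤ 21 * Ns * A₀ ^ 2 := by
      have h4 : ∑ i ∈ (univ : Finset (Fin 4)), c i * ∑ p, ∑ p', ‖((fwdDiff (dir i))^[3] (Gc p)) p'‖ ^ 2 ≤
          ∑ _i ∈ (univ : Finset (Fin 4)), 4 * Ns * A₀ ^ 2 := sum_le_sum fun i _ => hspace i
      rw [sum_const, card_univ, Fintype.card_fin, nsmul_eq_mul] at h4
      push_cast at h4
      linarith [hsq0, htime, h4]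
    rw [← Real.sqrt_sq hA₀, ← Real.sqrt_mul (by positivity)]
    refine Real.sqrt_le_sqrt ?_
    rw [pow_one]
    calc (P : ℝ) * (L : ℝ) ^ 2 * _ ≤ (P : ℝ) * (L : ℝ) ^ 2 * (21 * Ns * A₀ ^ 2) :=
          mul_le_mul_of_nonneg_left hbr (by positivity)
      _ = 21 * P * (L : ℝ) ^ 2 * Ns * A₀ ^ 2 := by ring
  calc _ ≤ Real.sqrt (32768 * (1 / s₀ + 1) *
          ((1 + 2 * Real.sqrt 2 * s₁ / (s₂ * Real.sqrt ((v 0 : ℝ) ^ 2 + (v 1 : ℝ) ^ 2)) +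
              2 * Real.sqrt 2 * s₁ / (s₃ * Real.sqrt ((v 0 : ℝ) ^ 2 + (v 1 : ℝ) ^ 2))) ^ 2 *
            (4 * ((2 * Real.sqrt 2 / (s₂ * Real.sqrt ((v 0 : ℝ) ^ 2 + (v 1 : ℝ) ^ 2)) + 2) *
              (2 * Real.sqrt 2 / (s₃ * Real.sqrt ((v 0 : ℝ) ^ 2 + (v 1 : ℝ) ^ 2)) + 2)))
            + 16 * (1 / s₁ + 1) ^ 2 / (1 + s₁ * R₀))) * (Real.sqrt (21 * P * (L : ℝ) ^ 2 * Ns) * A₀) :=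
        mul_le_mul hweight hsymbol (Real.sqrt_nonneg _) (Real.sqrt_nonneg _)
    _ = _ := by ring

end Summit.HubbardSuperconductivity.HubbardSuperconductivity.Theorems.TorusFourierL2

end
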